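import Mathlib

/-!
# `DivisionGap.PerMultiplesHard` (stmt-ValiantsHypothesis-5068), line `uncharged-face-walk`:
helpers for stub `stub_regularPairClean` — cleaning a dense regular pair (lead c9, cycle 9)

Elementary bipartite bookkeeping for a bipartite graph `X ⊆ Fin N × Fin N` (rows `e.1`,
columns `e.2`) and a `1/P`-regular pair `(V, W)`, `#V = #W = m`, of reference density `p`
(regularity: for `S ⊆ V`, `T ⊆ W` with `P #S ≥ m`, `P #T ≥ m`, the density of `(S, T)` is
within `1/P` of `p`):

* double counting `e(S,T) = Σ_{x ∈ S} deg_T x = Σ_{y ∈ T} deg_S y`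
  (`edges_eq_sum_rows`, `edges_eq_sum_cols`);
* the two "few exceptions" lemmas `few_lowRows` / `few_lowCols`: a row set `S ⊆ V` all of whose
  degrees into a column set `T ⊆ W` with `P #T ≥ m` are `< (p - 1/P) #T` has `P #S < m` (ONE
  application of regularity to `(S, T)`), and symmetrically for columns;
* the construction `stub_regularPairClean_sets` (a registered sub-goal of the crux item) of
  `A ⊆ V`, `B₀, B ⊆ W` of a prescribed size `a`
  (`8a ≤ m ≤ P a`, `P ≥ 16`): all rows of `A` have `≥ (p - 1/P) a` neighbours in `B₀`, all
  columns of `B` have `≥ (p - 1/P) a` neighbours in `A`, and `B ⊇ B₀ ∖ Bad` with `P #Bad < m`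
  (`B` trades the bad columns of `B₀` for good fresh ones of `W ∖ B₀`);
* Hall's theorem (`Finset.all_card_le_biUnion_card_iff_exists_injective`) packaged for minimum
  degrees `δ` plus "row sets larger than `δ` miss fewer than `δ` columns" (`hall_condition`,
  `exists_matching`);
* the transfer of regularity to `(A, B)` at level `P / 16` (`regularity_transfer`).
[folklore]
-/

noncomputable section

-- `Summit.ValiantsHypothesis.ValiantsHypothesis.…` is the tree's mandated layout (Sub = Summit).
set_option linter.dupNamespace false

open Finset
open scoped BigOperators

namespace Summit.ValiantsHypothesis.ValiantsHypothesis.Theorems.DivisionGap.PerMultiplesHard.RegularPairCleanAux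

variable {N : ℕ}

/-- The `X`-edges between `S` and `T` are the pairs of `S ×ˢ T` lying in `X`. [folklore] -/
theorem edges_eq_filter_product (X : Finset (Fin N × Fin N)) (S T : Finset (Fin N)) :
    (X.filter fun e => e.1 ∈ S ∧ e.2 ∈ T) = (S ×ˢ T).filter (fun e => e ∈ X) := by
  ext e
  simp only [mem_filter, mem_product]
  tauto

/-- Double counting by rows: `e(S,T) = Σ_{x ∈ S} deg_T x`. [folklore] -/
theorem edges_eq_sum_rows (X : Finset (Fin N × Fin N)) (S T : Finset (Fin N)) :
    (X.filter fun e => e.1 ∈ S ∧ e.2 ∈ T).card =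
      ∑ x ∈ S, (T.filter fun y => (x, y) ∈ X).card := by
  rw [edges_eq_filter_product, card_filter, sum_product]
  simp only [card_filter]

/-- Double counting by columns: `e(S,T) = Σ_{y ∈ T} deg_S y`. [folklore] -/
theorem edges_eq_sum_cols (X : Finset (Fin N × Fin N)) (S T : Finset (Fin N)) :
    (X.filter fun e => e.1 ∈ S ∧ e.2 ∈ T).card =
      ∑ y ∈ T, (S.filter fun x => (x, y) ∈ X).card := by
  rw [edges_eq_filter_product, card_filter, sum_product_right]
  simp only [card_filter]

/-- FEW ROWS OF LOW DEGREE.  If every row of `S ⊆ V` has fewer than `(p - 1/P) #T` neighbours in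
a column set `T ⊆ W` with `P #T ≥ m ≥ 1`, then `P #S < m`: otherwise regularity of `(S, T)`
forces `e(S,T) ≥ (p - 1/P) #S #T`, while summing the row degrees gives strictly less.
[folklore] -/
theorem few_lowRows {m P : ℕ} {X : Finset (Fin N × Fin N)} {V W S T : Finset (Fin N)} {p : ℝ}
    (hreg : ∀ S ⊆ V, ∀ T ⊆ W, m ≤ P * S.card → m ≤ P * T.card →
      |((X.filter fun e => e.1 ∈ S ∧ e.2 ∈ T).card : ℝ) / ((S.card : ℝ) * (T.card : ℝ)) - p| ≤
        1 / (P : ℝ))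
    (hm : 1 ≤ m) (hS : S ⊆ V) (hT : T ⊆ W) (hPT : m ≤ P * T.card)
    (hlow : ∀ x ∈ S, ((T.filter fun y => (x, y) ∈ X).card : ℝ) < (p - 1 / (P : ℝ)) * T.card) :
    P * S.card < m := by
  by_contra h
  push Not at h
  have hSpos : 0 < S.card := Nat.pos_of_ne_zero (by rintro h0; rw [h0, mul_zero] at h; omega)
  have hTpos : 0 < T.card := Nat.pos_of_ne_zero (by rintro h0; rw [h0, mul_zero] at hPT; omega)
  have hsum : ((X.filter fun e => e.1 ∈ S ∧ e.2 ∈ T).card : ℝ) <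
      (p - 1 / (P : ℝ)) * ((S.card : ℝ) * (T.card : ℝ)) := by
    rw [edges_eq_sum_rows, Nat.cast_sum]
    calc ∑ x ∈ S, (((T.filter fun y => (x, y) ∈ X).card : ℕ) : ℝ)
        < ∑ _x ∈ S, (p - 1 / (P : ℝ)) * T.card :=
          sum_lt_sum_of_nonempty (card_pos.1 hSpos) hlow
      _ = (p - 1 / (P : ℝ)) * ((S.card : ℝ) * (T.card : ℝ)) := by
          rw [sum_const, nsmul_eq_mul]; ring
  have hpos : (0 : ℝ) < (S.card : ℝ) * (T.card : ℝ) :=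
    mul_pos (Nat.cast_pos.2 hSpos) (Nat.cast_pos.2 hTpos)
  have h2 : p - 1 / (P : ℝ) ≤
      ((X.filter fun e => e.1 ∈ S ∧ e.2 ∈ T).card : ℝ) / ((S.card : ℝ) * (T.card : ℝ)) := by
    have := (abs_sub_le_iff.1 (hreg S hS T hT h hPT)).2
    linarith
  rw [le_div_iff₀ hpos] at h2
  exact lt_irrefl _ (h2.trans_lt hsum)

/-- FEW COLUMNS OF LOW DEGREE (the transpose of `few_lowRows`).  If every column of `T ⊆ W` has
fewer than `(p - 1/P) #S` neighbours in a row set `S ⊆ V` with `P #S ≥ m ≥ 1`, then `P #T < m`.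
[folklore] -/
theorem few_lowCols {m P : ℕ} {X : Finset (Fin N × Fin N)} {V W S T : Finset (Fin N)} {p : ℝ}
    (hreg : ∀ S ⊆ V, ∀ T ⊆ W, m ≤ P * S.card → m ≤ P * T.card →
      |((X.filter fun e => e.1 ∈ S ∧ e.2 ∈ T).card : ℝ) / ((S.card : ℝ) * (T.card : ℝ)) - p| ≤
        1 / (P : ℝ))
    (hm : 1 ≤ m) (hS : S ⊆ V) (hT : T ⊆ W) (hPS : m ≤ P * S.card)
    (hlow : ∀ y ∈ T, ((S.filter fun x => (x, y) ∈ X).card : ℝ) < (p - 1 / (P : ℝ)) * S.card) :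
    P * T.card < m := by
  by_contra h
  push Not at h
  have hSpos : 0 < S.card := Nat.pos_of_ne_zero (by rintro h0; rw [h0, mul_zero] at hPS; omega)
  have hTpos : 0 < T.card := Nat.pos_of_ne_zero (by rintro h0; rw [h0, mul_zero] at h; omega)
  have hsum : ((X.filter fun e => e.1 ∈ S ∧ e.2 ∈ T).card : ℝ) <
      (p - 1 / (P : ℝ)) * ((S.card : ℝ) * (T.card : ℝ)) := by
    rw [edges_eq_sum_cols, Nat.cast_sum]
    calc ∑ y ∈ T, (((S.filter fun x => (x, y) ∈ X).card : ℕ) : ℝ)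
        < ∑ _y ∈ T, (p - 1 / (P : ℝ)) * S.card :=
          sum_lt_sum_of_nonempty (card_pos.1 hTpos) hlow
      _ = (p - 1 / (P : ℝ)) * ((S.card : ℝ) * (T.card : ℝ)) := by
          rw [sum_const, nsmul_eq_mul]; ring
  have hpos : (0 : ℝ) < (S.card : ℝ) * (T.card : ℝ) :=
    mul_pos (Nat.cast_pos.2 hSpos) (Nat.cast_pos.2 hTpos)
  have h2 : p - 1 / (P : ℝ) ≤
      ((X.filter fun e => e.1 ∈ S ∧ e.2 ∈ T).card : ℝ) / ((S.card : ℝ) * (T.card : ℝ)) := by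
    have := (abs_sub_le_iff.1 (hreg S hS T hT hPS h)).2
    linarith
  rw [le_div_iff₀ hpos] at h2
  exact lt_irrefl _ (h2.trans_lt hsum)

/-- Removing `r` from `s` loses at most `#r` elements of any sub-filter, and passing to a superset
`B ⊇ s \ r` loses none: `#(s.filter Q) ≤ #(B.filter Q) + #r`. [folklore] -/
theorem card_filter_le_of_sdiff_subset {α : Type*} [DecidableEq α] {s r B : Finset α}
    (h : s \ r ⊆ B) (Q : α → Prop) [DecidablePred Q] :
    (s.filter Q).card ≤ (B.filter Q).card + r.card := by
  calc (s.filter Q).card ≤ (B.filter Q ∪ r).card := by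
        refine card_le_card fun x hx => ?_
        rw [mem_filter] at hx
        rw [mem_union, mem_filter]
        by_cases hxr : x ∈ r
        · exact Or.inr hxr
        · exact Or.inl ⟨h (mem_sdiff.2 ⟨hx.1, hxr⟩), hx.2⟩
    _ ≤ (B.filter Q).card + r.card := card_union_le _ _

/-- THE CLEANING CONSTRUCTION (registered sub-goal `stub_regularPairClean_sets` of the crux item,
the first half of stub `stub_regularPairClean`).  Given the `1/P`-regular pair `(V, W)` of
reference density `p` and a size `a` with `8a ≤ m ≤ P a`, `P ≥ 16`: pick any `B₀ ⊆ W` of size `a`;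
the rows of `V` with `< (p - 1/P) a` neighbours in `B₀` are few (`few_lowRows` against `B₀`), so
some `A ⊆ V` of size `a` avoids them; the columns of `B₀` (resp. of `W ∖ B₀`) with `< (p - 1/P) a`
neighbours in `A` are few (`few_lowCols` against `A`), so the bad ones of `B₀` can be traded for as
many good ones of `W ∖ B₀`, giving `B ⊇ B₀ ∖ Bad` with `P · #Bad < m`. [folklore] -/
theorem stub_regularPairClean_sets :
    ∀ (N m P a : ℕ) (X : Finset (Fin N × Fin N)) (V W : Finset (Fin N)) (p : ℝ),
      (∀ S ⊆ V, ∀ T ⊆ W, m ≤ P * S.card → m ≤ P * T.card →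
        |(((X.filter fun e => e.1 ∈ S ∧ e.2 ∈ T).card : ℕ) : ℝ) / ((S.card : ℝ) * (T.card : ℝ)) - p| ≤
          1 / (P : ℝ)) →
      1 ≤ m → V.card = m → W.card = m → 8 * a ≤ m → m ≤ P * a → 16 ≤ P →
      ∃ A B₀ Bad B : Finset (Fin N), A ⊆ V ∧ A.card = a ∧ B₀ ⊆ W ∧ B₀.card = a ∧ B ⊆ W ∧
        B.card = a ∧ B₀ \ Bad ⊆ B ∧ P * Bad.card < m ∧
        (∀ x ∈ A, (p - 1 / (P : ℝ)) * a ≤ (((B₀.filter fun y => (x, y) ∈ X).card : ℕ) : ℝ)) ∧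
        (∀ y ∈ B, (p - 1 / (P : ℝ)) * a ≤ (((A.filter fun x => (x, y) ∈ X).card : ℕ) : ℝ)) := by
  intro N m P a X V W p hreg hm hV hW h8a hPa hP
  obtain ⟨B₀, hB₀W, hB₀⟩ := exists_subset_card_eq (show a ≤ W.card by omega)
  -- rows with at least `(p - 1/P) a` neighbours in `B₀`, and the few others
  obtain ⟨V₂, hV₂⟩ : ∃ V₂ : Finset (Fin N), V₂ = V.filter fun x =>
      (p - 1 / (P : ℝ)) * a ≤ ((B₀.filter fun y => (x, y) ∈ X).card : ℝ) := ⟨_, rfl⟩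
  obtain ⟨V₁, hV₁⟩ : ∃ V₁ : Finset (Fin N), V₁ = V.filter fun x =>
      ¬ ((p - 1 / (P : ℝ)) * a ≤ ((B₀.filter fun y => (x, y) ∈ X).card : ℝ)) := ⟨_, rfl⟩
  have hV₁lt : P * V₁.card < m := by
    rw [hV₁]
    refine few_lowRows hreg hm (filter_subset _ _) hB₀W (by rw [hB₀]; exact hPa) fun x hx => ?_
    rw [hB₀]
    exact not_le.1 (mem_filter.1 hx).2
  have hV₂a : a ≤ V₂.card := by
    have hsplit : V₂.card + V₁.card = V.card := by
      rw [hV₂, hV₁]; exact card_filter_add_card_filter_not _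
    have h16 : 16 * V₁.card ≤ P * V₁.card := Nat.mul_le_mul_right _ hP
    omega
  obtain ⟨A, hAV₂, hA⟩ := exists_subset_card_eq hV₂a
  have hAV : A ⊆ V := hAV₂.trans (by rw [hV₂]; exact filter_subset _ _)
  have hPA : m ≤ P * A.card := by rw [hA]; exact hPa
  have hrow : ∀ x ∈ A, (p - 1 / (P : ℝ)) * a ≤ ((B₀.filter fun y => (x, y) ∈ X).card : ℝ) := by
    intro x hx
    have := hAV₂ hx
    rw [hV₂, mem_filter] at this
    exact this.2
  -- bad columns of `B₀`, good fresh columns of `W \ B₀`, and the few others there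
  obtain ⟨Bad, hBad⟩ : ∃ Bad : Finset (Fin N), Bad = B₀.filter fun y =>
      ¬ ((p - 1 / (P : ℝ)) * a ≤ ((A.filter fun x => (x, y) ∈ X).card : ℝ)) := ⟨_, rfl⟩
  obtain ⟨Fresh, hFresh⟩ : ∃ Fresh : Finset (Fin N), Fresh = (W \ B₀).filter fun y =>
      (p - 1 / (P : ℝ)) * a ≤ ((A.filter fun x => (x, y) ∈ X).card : ℝ) := ⟨_, rfl⟩
  obtain ⟨Out, hOut⟩ : ∃ Out : Finset (Fin N), Out = (W \ B₀).filter fun y =>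
      ¬ ((p - 1 / (P : ℝ)) * a ≤ ((A.filter fun x => (x, y) ∈ X).card : ℝ)) := ⟨_, rfl⟩
  have hBadlt : P * Bad.card < m := by
    rw [hBad]
    refine few_lowCols hreg hm hAV ((filter_subset _ _).trans hB₀W) hPA fun y hy => ?_
    rw [hA]
    exact not_le.1 (mem_filter.1 hy).2
  have hOutlt : P * Out.card < m := by
    rw [hOut]
    refine few_lowCols hreg hm hAV ((filter_subset _ _).trans sdiff_subset) hPA fun y hy => ?_
    rw [hA]
    exact not_le.1 (mem_filter.1 hy).2
  have hBadB₀ : Bad ⊆ B₀ := by rw [hBad]; exact filter_subset _ _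
  have hFreshW : Fresh ⊆ W \ B₀ := by rw [hFresh]; exact filter_subset _ _
  have hBF : Bad.card ≤ Fresh.card := by
    have hsplit : Fresh.card + Out.card = (W \ B₀).card := by
      rw [hFresh, hOut]; exact card_filter_add_card_filter_not _
    rw [card_sdiff_of_subset hB₀W, hW, hB₀] at hsplit
    have h16 : 16 * Bad.card ≤ P * Bad.card := Nat.mul_le_mul_right _ hP
    have h16' : 16 * Out.card ≤ P * Out.card := Nat.mul_le_mul_right _ hP
    omega
  obtain ⟨F, hFF, hF⟩ := exists_subset_card_eq hBF
  have hFW : F ⊆ W \ B₀ := hFF.trans hFreshW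
  have hdisj : Disjoint (B₀ \ Bad) F :=
    disjoint_left.2 fun y hy hyF => (mem_sdiff.1 (hFW hyF)).2 (mem_sdiff.1 hy).1
  refine ⟨A, B₀, Bad, B₀ \ Bad ∪ F, hAV, hA, hB₀W, hB₀,
    union_subset (sdiff_subset.trans hB₀W) (hFW.trans sdiff_subset), ?_, subset_union_left,
    hBadlt, hrow, fun y hy => ?_⟩
  · rw [card_union_of_disjoint hdisj, card_sdiff_of_subset hBadB₀, hB₀, hF]
    have : Bad.card ≤ a := hB₀ ▸ card_le_card hBadB₀
    omega
  · rcases mem_union.1 hy with hy | hy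
    · rw [mem_sdiff, hBad, mem_filter, not_and, not_not] at hy
      exact hy.2 hy.1
    · have := hFF hy
      rw [hFresh, mem_filter] at this
      exact this.2

/-- HALL'S CONDITION inside `A`.  Rows of `A` have `≥ δ` neighbours in `B`, columns of `B` have
`≥ δ` neighbours in `A` (`#A = #B = a`), and every `U ⊆ A` with `#U > δ` misses fewer than `δ`
columns of `B` entirely; then `#U ≤ #N_B(U)` for every `U ⊆ A`: small `U` are covered by one
neighbourhood, and for large `U` either `#N_B(U) ≥ #U` directly or every column sees `U`
(its `≥ δ > a - #N_B(U) > #(A ∖ U)` neighbours in `A` cannot all avoid `U`). [folklore] -/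
theorem hall_condition {a : ℕ} {X : Finset (Fin N × Fin N)} {A B : Finset (Fin N)} {δ : ℝ}
    (hA : A.card = a) (hB : B.card = a)
    (hrow : ∀ x ∈ A, δ ≤ ((B.filter fun y => (x, y) ∈ X).card : ℝ))
    (hcol : ∀ y ∈ B, δ ≤ ((A.filter fun x => (x, y) ∈ X).card : ℝ))
    (hexc : ∀ U ⊆ A, δ < U.card →
      ((B.filter fun y => ∀ x ∈ U, (x, y) ∉ X).card : ℝ) < δ)
    {U : Finset (Fin N)} (hUA : U ⊆ A) :
    U.card ≤ (U.biUnion fun x => B.filter fun y => (x, y) ∈ X).card := by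
  rcases U.eq_empty_or_nonempty with rfl | ⟨x₀, hx₀⟩
  · simp
  have hUa : U.card ≤ a := hA ▸ card_le_card hUA
  by_cases hsmall : (U.card : ℝ) ≤ δ
  · -- the neighbourhood of `x₀` alone suffices
    have h1 : (B.filter fun y => (x₀, y) ∈ X) ⊆ U.biUnion fun x => B.filter fun y => (x, y) ∈ X :=
      subset_biUnion_of_mem (fun x => B.filter fun y => (x, y) ∈ X) hx₀
    have h2 : (U.card : ℝ) ≤ ((U.biUnion fun x => B.filter fun y => (x, y) ∈ X).card : ℝ) :=
      hsmall.trans ((hrow x₀ (hUA hx₀)).trans (by exact_mod_cast card_le_card h1))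
    exact_mod_cast h2
  · push Not at hsmall
    have hTlt := hexc U hUA hsmall
    -- `B ⊆ N_B(U) ∪ T`
    have hcover : B ⊆ (U.biUnion fun x => B.filter fun y => (x, y) ∈ X) ∪
        B.filter fun y => ∀ x ∈ U, (x, y) ∉ X := by
      intro y hy
      rw [mem_union, mem_biUnion, mem_filter]
      by_cases h : ∃ x ∈ U, (x, y) ∈ X
      · obtain ⟨x, hx, hxy⟩ := h
        exact Or.inl ⟨x, hx, mem_filter.2 ⟨hy, hxy⟩⟩
      · push Not at h
        exact Or.inr ⟨hy, h⟩
    have hcard : a ≤ (U.biUnion fun x => B.filter fun y => (x, y) ∈ X).card +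
        (B.filter fun y => ∀ x ∈ U, (x, y) ∉ X).card :=
      hB ▸ (card_le_card hcover).trans (card_union_le _ _)
    by_contra hlt
    push Not at hlt
    -- then every column of `B` sees `U`
    have hall : B ⊆ U.biUnion fun x => B.filter fun y => (x, y) ∈ X := by
      intro y hy
      have hlt2 : (A \ U).card < (A.filter fun x => (x, y) ∈ X).card := by
        rw [card_sdiff_of_subset hUA, hA]
        have : ((a - U.card : ℕ) : ℝ) < ((A.filter fun x => (x, y) ∈ X).card : ℝ) :=
          calc ((a - U.card : ℕ) : ℝ)
              < ((B.filter fun y => ∀ x ∈ U, (x, y) ∉ X).card : ℝ) := by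
                exact_mod_cast (show a - U.card < _ by omega)
            _ < δ := hTlt
            _ ≤ _ := hcol y hy
        exact_mod_cast this
      obtain ⟨x, hx, hxn⟩ := exists_mem_notMem_of_card_lt_card hlt2
      rw [mem_filter] at hx
      rw [mem_sdiff, not_and, not_not] at hxn
      exact mem_biUnion.2 ⟨x, hxn hx.1, mem_filter.2 ⟨hy, hx.2⟩⟩
    have := card_le_card hall
    rw [hB] at this
    omega

/-- THE MATCHING.  Under the hypotheses of `hall_condition`, Hall's marriage theorem
(`Finset.all_card_le_biUnion_card_iff_exists_injective`, applied to the family that is the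
`B`-neighbourhood on `A` and everything off `A`) gives an injective `g : Fin N → Fin N` with
`g x ∈ B`, `(x, g x) ∈ X` for `x ∈ A`. [folklore] -/
theorem exists_matching {a : ℕ} {X : Finset (Fin N × Fin N)} {A B : Finset (Fin N)} {δ : ℝ}
    (hA : A.card = a) (hB : B.card = a)
    (hrow : ∀ x ∈ A, δ ≤ ((B.filter fun y => (x, y) ∈ X).card : ℝ))
    (hcol : ∀ y ∈ B, δ ≤ ((A.filter fun x => (x, y) ∈ X).card : ℝ))
    (hexc : ∀ U ⊆ A, δ < U.card →
      ((B.filter fun y => ∀ x ∈ U, (x, y) ∉ X).card : ℝ) < δ) :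
    ∃ g : Fin N → Fin N, (∀ x ∈ A, g x ∈ B ∧ (x, g x) ∈ X) ∧
      (∀ x ∈ A, ∀ x' ∈ A, g x = g x' → x = x') := by
  obtain ⟨t, ht⟩ : ∃ t : Fin N → Finset (Fin N),
      t = fun x => if x ∈ A then B.filter fun y => (x, y) ∈ X else univ := ⟨_, rfl⟩
  have hall : ∀ U : Finset (Fin N), U.card ≤ (U.biUnion t).card := by
    intro U
    by_cases hUA : U ⊆ A
    · have hcongr : U.biUnion t = U.biUnion fun x => B.filter fun y => (x, y) ∈ X :=
        biUnion_congr rfl fun x hx => by simp only [ht, if_pos (hUA hx)]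
      rw [hcongr]
      exact hall_condition hA hB hrow hcol hexc hUA
    · obtain ⟨x, hxU, hxA⟩ := not_subset.1 hUA
      have htx : t x = univ := by simp only [ht, if_neg hxA]
      calc U.card ≤ (univ : Finset (Fin N)).card := card_le_card (subset_univ U)
        _ = (t x).card := by rw [htx]
        _ ≤ (U.biUnion t).card := card_le_card (subset_biUnion_of_mem t hxU)
  obtain ⟨g, hginj, hgt⟩ := (all_card_le_biUnion_card_iff_exists_injective t).1 hall
  refine ⟨g, fun x hx => ?_, fun x _ x' _ h => hginj h⟩
  have := hgt x
  simp only [ht, if_pos hx, mem_filter] at this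
  exact this

/-- REGULARITY TRANSFER.  Regularity of `(V, W)` at level `P ≥ 16` passes to `(A, B)` (`A ⊆ V`,
`B ⊆ W`, `#A = #B = a`, `16 a ≥ m`) at level `P / 16` for its own density: `a ≤ (P/16) #S` gives
`m ≤ P #S`, and both `d(S,T)` and `d(A,B)` are within `1/P` of `p`, so they differ by
`≤ 2/P ≤ 1/(P/16)`. [folklore] -/
theorem regularity_transfer {m P a : ℕ} {X : Finset (Fin N × Fin N)} {V W A B : Finset (Fin N)}
    {p : ℝ}
    (hreg : ∀ S ⊆ V, ∀ T ⊆ W, m ≤ P * S.card → m ≤ P * T.card →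
      |((X.filter fun e => e.1 ∈ S ∧ e.2 ∈ T).card : ℝ) / ((S.card : ℝ) * (T.card : ℝ)) - p| ≤
        1 / (P : ℝ))
    (hAV : A ⊆ V) (hBW : B ⊆ W) (hA : A.card = a) (hB : B.card = a) (h16a : m ≤ 16 * a)
    (hP : 16 ≤ P) :
    ∀ S ⊆ A, ∀ T ⊆ B, a ≤ (P / 16) * S.card → a ≤ (P / 16) * T.card →
      |((X.filter fun e => e.1 ∈ S ∧ e.2 ∈ T).card : ℝ) / ((S.card : ℝ) * (T.card : ℝ)) -
        ((X.filter fun e => e.1 ∈ A ∧ e.2 ∈ B).card : ℝ) / ((a : ℝ) * (a : ℝ))| ≤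
      1 / ((P / 16 : ℕ) : ℝ) := by
  intro S hS T hT hPS hPT
  have hq : 16 * (P / 16) ≤ P := Nat.mul_div_le P 16
  have key : ∀ c : ℕ, a ≤ (P / 16) * c → m ≤ P * c := by
    intro c hc
    have h1 : 16 * ((P / 16) * c) ≤ P * c := by
      rw [← Nat.mul_assoc]; exact Nat.mul_le_mul_right _ hq
    omega
  have hPa : m ≤ P * a := le_trans h16a (Nat.mul_le_mul_right _ hP)
  have h1 := hreg S (hS.trans hAV) T (hT.trans hBW) (key _ hPS) (key _ hPT)
  have h2 := hreg A hAV B hBW (by rw [hA]; exact hPa) (by rw [hB]; exact hPa)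
  rw [hA, hB, abs_sub_comm] at h2
  have hPpos : (0 : ℝ) < P := by exact_mod_cast (show 0 < P by omega)
  have hq1 : (0 : ℝ) < ((P / 16 : ℕ) : ℝ) := by exact_mod_cast (show 0 < P / 16 by omega)
  have hq2 : ((P / 16 : ℕ) : ℝ) * 2 ≤ (P : ℝ) := by
    exact_mod_cast (show (P / 16) * 2 ≤ P by omega)
  have h4 : 1 / (P : ℝ) + 1 / (P : ℝ) ≤ 1 / ((P / 16 : ℕ) : ℝ) := by
    rw [← add_div, div_le_div_iff₀ hPpos hq1]
    linarith
  exact ((abs_sub_le _ p _).trans (add_le_add h1 h2)).trans h4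

end Summit.ValiantsHypothesis.ValiantsHypothesis.Theorems.DivisionGap.PerMultiplesHard.RegularPairCleanAux
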